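import Literature.Combinatorics.SimpleGraph.HarmonicMorphisms
import Mathlib.GroupTheory.Index
import HarnessLib

/-!
# Harmonic morphisms II: constant-or-surjective, the push-forward of functions and principal
# divisors, the induced maps `φ_* : Jac(G) → Jac(G′)`, `φ^* : Jac(G′) → Jac(G)`, `φ_*φ^* = deg(φ)`,
# `κ(G′) ∣ κ(G)`, and `r_{G′}(φ_*(D)) ≥ r_G(D)` (Baker–Norine 2009, §2.1 Lemma 11, §4.1)

Source (held, read at the page; statements VERBATIM). M. Baker, S. Norine, *Harmonic morphisms
and hyperelliptic graphs*, Int. Math. Res. Not. IMRN 2009, no. 15, 2914–2955 [BakerNorine2009]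
(held text `paper:arxiv-0707.1309`, chunks p0007, p0011–p0012).

§2.1, **Lemma 11.** «Let `φ : G → G′` be a harmonic morphism with `|V(G′)| > 1`. Then
`deg(φ) = 0` if and only if `φ` is constant, and `deg(φ) > 0` if and only if `φ` is surjective.»
(proof: «if `deg(φ) = 0` […] Since `m_φ(x) = 0`, it follows that `φ(e) = y` for every edge `e`
with `x ∈ e`. Thus `φ(x′) = y` for every neighbor `x′` of `x`. As `G` is connected, it follows
that every vertex […] is mapped under `φ` to `y`.»)

§4.1. **Lemma 24.** «Let `φ : G → G′` be a harmonic morphism, and let `D′ ∈ Div(G′)`. Then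
`φ_*(φ^*(D′)) = deg(φ)D′`.» «We define `φ_* f : V(G′) → A` by
`φ_* f(y) := Σ_{x ∈ V(G), φ(x) = y} m_φ(x) f(x)` and `φ^* f′ : V(G) → A` by `φ^* f′ := f′ ∘ φ`.»
**Proposition 25.** «Let `φ : G → G′` be a harmonic morphism, let `f : V(G) → ℤ` and
`f′ : V(G′) → ℤ`. Then (4.1) `φ_*(div(f)) = div(φ_* f)` and (4.2) `φ^*(div(f′)) = div(φ^* f′)`.»
**Corollary 26.** «If `φ : G → G′` is a harmonic morphism, then `φ_*(Prin(G)) ⊆ Prin(G′)` and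
`φ^*(Prin(G′)) ⊆ Prin(G)`.» «As a consequence of Corollary 26, we see that `φ` induces group
homomorphisms (which we continue to denote by `φ_*, φ^*`) `φ_* : Jac(G) → Jac(G′)`,
`φ^* : Jac(G′) → Jac(G)`.» **Corollary 28.** «If `φ : G → G′` is a non-constant harmonic
morphism, then for every `D ∈ Div(G)` we have `r_{G′}(φ_*(D)) ≥ r_G(D)`.» (proof: «For every
effective divisor `E′ ∈ Div(G′)` of degree `k`, we can choose `E ∈ Div(G)` such that
`φ_*(E) = E′`. If `r_G(D) ≥ k`, then by definition `D − E = F + P` with `F` effective and `P`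
principal. Applying `φ_*` […] `D′ − E′` is equivalent to the effective divisor `φ_*(F)`».)
**Lemma 29.** «Let `φ : G → G′` be a non-constant harmonic morphism. Then
`φ_* : Jac(G) → Jac(G′)` is surjective.» §4.2, **Corollary 31.** «If there exists a non-constant
harmonic morphism from `G` to `G′`, then `κ_{G′}` divides `κ_G`» (`κ_G = |Jac(G)|` the number of
spanning trees).

## What is formalised (simple graphs, the setting fixed in `HarmonicMorphisms`; vocabulary:
## `IsHarmonicMorphism`, `horizMult` = `m_φ`, `vertMult` = `v_φ`, `harmonicDegree G G′ φ y` =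
## `deg(φ)` read at `y`, `divPushforward` = `φ_*`, `divPullback` = `φ^*`, `div(f) = Δ(f) =
## G.lapMatrix ℤ *ᵥ f`, `Prin(G) = laplacianLattice G`, `Jac(G) = criticalGroup G`)

* §1 `φ_*` on divisors is additive, preserves the degree (`sum_divPushforward`) and effectivity,
  `φ_*((x)) = (φ(x))`, and for surjective `φ` every divisor is a push-forward of one of the same
  degree, effective if it is (`exists_divPushforward_eq`; the choice «`E` with `φ_*(E) = E′`»);
* §2 **Lemma 11**: `deg(φ) = 0 ↔ φ` constant; `deg(φ) > 0 ↔ φ` surjective (`|V(G′)| > 1`);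
* §3 **Lemma 24** `φ_*(φ^* D′) = deg(φ) D′`;
* §4 `fnPushforward` (`φ_* f`) and **Proposition 25 (4.1)** `φ_*(Δ f) = Δ′(φ_* f)` (a double
  count of the pairs `x ∼ u` over the fibre of `y`; (4.2) is `divPullback_lapMatrix_mulVec` of
  `HarmonicMorphisms`); **Corollary 26** `φ_*` preserves linear equivalence;
* §5 the induced homomorphisms `jacPushforward : Jac(G) →+ Jac(G′)` and
  `jacPullback : Jac(G′) →+ Jac(G)` (the latter for connected `G′`, where `deg(φ^* D′) =
  deg(φ) deg(D′)`), their values on representatives, **Lemma 24** on `Jac`, **Lemma 29**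
  (`φ_*` surjective for surjective `φ`), **Corollary 31** `|Jac(G′)| ∣ |Jac(G)|`, i.e.
  `κ(G′) ∣ κ(G)`, for a non-constant harmonic morphism of connected graphs;
* §6 **Corollary 28** `r_G(D) ≤ r_{G′}(φ_* D)`.

Definitions with bodies and theorems only; no `sorry`; no named facts.
-/

open Finset SimpleGraph Matrix
open Literature.Combinatorics.SimpleGraph.ChipFiring

namespace Literature.Combinatorics.SimpleGraph.BakerNorine

variable {V V' : Type*} [Fintype V] [Fintype V'] [DecidableEq V']
variable (G : SimpleGraph V) [DecidableRel G.Adj] (G' : SimpleGraph V') [DecidableRel G'.Adj]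

/-! ### §1 The push-forward of divisors -/

section Divisors

omit [Fintype V'] in
/-- `φ_*` is additive. [cite: BakerNorine2009, §2.3 («the push-forward homomorphism»)] -/
theorem divPushforward_add (φ : V → V') (D₁ D₂ : V → ℤ) :
    divPushforward φ (D₁ + D₂) = divPushforward φ D₁ + divPushforward φ D₂ := by
  funext y
  simp only [divPushforward_apply, Pi.add_apply, Finset.sum_add_distrib]

omit [Fintype V'] in
/-- `φ_*(D₁ − D₂) = φ_* D₁ − φ_* D₂`. [cite: BakerNorine2009, §2.3 («the push-forward
homomorphism»)] -/
theorem divPushforward_sub (φ : V → V') (D₁ D₂ : V → ℤ) :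
    divPushforward φ (D₁ - D₂) = divPushforward φ D₁ - divPushforward φ D₂ := by
  funext y
  simp only [divPushforward_apply, Pi.sub_apply, Finset.sum_sub_distrib]

omit [Fintype V'] in
/-- `φ_*(0) = 0`. [cite: BakerNorine2009, §2.3 («the push-forward homomorphism»)] -/
theorem divPushforward_zero (φ : V → V') : divPushforward φ (0 : V → ℤ) = 0 := by
  funext y
  simp only [divPushforward_apply, Pi.zero_apply, Finset.sum_const_zero]

omit [Fintype V'] in
/-- `φ_*((x)) = (φ(x))` («`φ_*(D) = Σ_x D(x)(φ(x))`» on a single vertex).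
[cite: BakerNorine2009, §2.3 (eq. (2.4))] -/
theorem divPushforward_single [DecidableEq V] (φ : V → V') (x : V) (c : ℤ) :
    divPushforward φ (Pi.single x c) = Pi.single (φ x) c := by
  funext y
  rw [divPushforward_apply]
  by_cases hy : φ x = y
  · subst hy
    rw [Pi.single_eq_same, Finset.sum_eq_single_of_mem x (by simp) fun u _ hux => by
      rw [Pi.single_eq_of_ne hux]]
    rw [Pi.single_eq_same]
  · rw [Pi.single_eq_of_ne (Ne.symm hy)]
    refine Finset.sum_eq_zero fun u hu => ?_
    have hux : u ≠ x := by
      rintro rfl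
      exact hy (mem_filter.1 hu).2
    rw [Pi.single_eq_of_ne hux]

/-- **`φ_*` preserves the degree**: `deg(φ_* D) = deg(D)`.
[cite: BakerNorine2009, §4.1 (proof of Lemma 29: «surjectivity on the level of Jacobians»)] -/
theorem sum_divPushforward (φ : V → V') (D : V → ℤ) :
    ∑ y, divPushforward φ D y = ∑ x, D x := by
  have hmaps : ∀ x ∈ (univ : Finset V), φ x ∈ (univ : Finset V') := fun x _ => mem_univ _
  simp only [divPushforward_apply]
  exact Finset.sum_fiberwise_of_maps_to hmaps D

omit [Fintype V'] in
/-- `φ_*` preserves effectivity. [cite: BakerNorine2009, §4.1 (proof of Corollary 28: «the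
effective divisor `φ_*(F)`»)] -/
theorem divPushforward_nonneg (φ : V → V') {D : V → ℤ} (hD : 0 ≤ D) :
    0 ≤ divPushforward φ D := fun y => by
  rw [Pi.zero_apply, divPushforward_apply]
  exact Finset.sum_nonneg fun x _ => hD x

/-- For a surjective `φ`, every divisor `D′` of `G′` is `φ_*(D)` for a divisor `D` of the same
degree, effective when `D′` is («we can choose `E ∈ Div(G)` such that `φ_*(E) = E′`»; «`φ_*` is
a surjective map from `Div(G)` to `Div(G′)`»).
[cite: BakerNorine2009, §4.1 (proofs of Corollary 28 and Lemma 29)] -/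
theorem exists_divPushforward_eq {φ : V → V'} (hφs : Function.Surjective φ) (D' : V' → ℤ) :
    ∃ D : V → ℤ, divPushforward φ D = D' ∧ ∑ x, D x = ∑ y, D' y ∧ (0 ≤ D' → 0 ≤ D) := by
  classical
  -- a section `σ` of `φ`; put the `D′(y)` chips on `σ(y)`
  choose σ hσ using hφs
  have hpush : divPushforward φ (fun x => if σ (φ x) = x then D' (φ x) else 0) = D' := by
    funext y
    rw [divPushforward_apply]
    rw [Finset.sum_congr rfl fun x hx => by rw [(mem_filter.1 hx).2]]
    rw [Finset.sum_ite_eq,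
      if_pos (show σ y ∈ univ.filter (fun x => φ x = y) from mem_filter.2 ⟨mem_univ _, hσ y⟩)]
  refine ⟨fun x => if σ (φ x) = x then D' (φ x) else 0, hpush, ?_, fun hD' x => ?_⟩
  · rw [← sum_divPushforward φ, hpush]
  · dsimp only
    split_ifs
    · exact hD' _
    · exact le_rfl

end Divisors

/-! ### §2 Lemma 11: constant or surjective -/

section ConstantOrSurjective

variable {G G'} {φ : V → V'} (hφ : IsHarmonicMorphism G G' φ)
include hφ

/-- A constant map has `m_φ ≡ 0`, hence degree `0` at every vertex («If `φ` is constant, then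
clearly `deg(φ) = 0`»). [cite: BakerNorine2009, Lemma 11] -/
theorem IsHarmonicMorphism.harmonicDegree_eq_zero_of_forall_eq (h : ∀ x x' : V, φ x = φ x')
    (y : V') : harmonicDegree G G' φ y = 0 := by
  rw [harmonicDegree_apply]
  refine Finset.sum_eq_zero fun x _ => ?_
  by_cases hex : ∃ y', G'.Adj (φ x) y'
  · obtain ⟨y', hy'⟩ := hex
    rw [hφ.horizMult_eq hy', Finset.card_eq_zero, Finset.filter_eq_empty_iff]
    intro u _ hu
    rw [h u x] at hu
    exact G'.ne_of_adj hy' hu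
  · exact horizMult_eq_zero_of_forall_not_adj (not_exists.1 hex)

/-- **Lemma 11 (first half, `⇒`)**: if `deg(φ) = 0` then `φ` is constant (`G` connected; the
degree read at any vertex of a connected `G′`). [cite: BakerNorine2009, Lemma 11] -/
theorem IsHarmonicMorphism.forall_eq_of_harmonicDegree_eq_zero (hG : G.Connected)
    (hG' : G'.Connected) {y₀ : V'} (h : harmonicDegree G G' φ y₀ = 0) (x x' : V) :
    φ x = φ x' := by
  -- every multiplicity vanishes, so every edge is vertical
  have hm : ∀ z : V, horizMult G G' φ z = 0 := fun z => by
    have hz := hφ.harmonicDegree_eq hG' (φ z) y₀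
    rw [h, harmonicDegree_apply] at hz
    exact (Finset.sum_eq_zero_iff.1 hz) z (mem_filter.2 ⟨mem_univ _, rfl⟩)
  have hedge : ∀ ⦃z u : V⦄, G.Adj z u → φ z = φ u := fun z u hzu => by
    rcases hφ.adj_or_eq hzu with hadj | heq
    · exfalso
      have h1 := hφ.horizMult_eq hadj
      rw [hm z] at h1
      have : u ∈ ({w ∈ G.neighborFinset z | φ w = φ u} : Finset V) :=
        mem_filter.2 ⟨(mem_neighborFinset _ _ _).2 hzu, rfl⟩
      rw [Finset.card_eq_zero.1 h1.symm] at this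
      exact Finset.notMem_empty _ this
    · exact heq
  obtain ⟨p⟩ := hG.preconnected x x'
  induction p with
  | nil => rfl
  | cons hadj _ ih => exact (hedge hadj).trans ih

/-- **Lemma 11 (first half)**: «`deg(φ) = 0` if and only if `φ` is constant» (`G, G′`
connected). [cite: BakerNorine2009, Lemma 11] -/
theorem IsHarmonicMorphism.harmonicDegree_eq_zero_iff (hG : G.Connected) (hG' : G'.Connected)
    (y₀ : V') : harmonicDegree G G' φ y₀ = 0 ↔ ∀ x x' : V, φ x = φ x' :=
  ⟨fun h => hφ.forall_eq_of_harmonicDegree_eq_zero hG hG' h,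
    fun h => hφ.harmonicDegree_eq_zero_of_forall_eq h y₀⟩

omit hφ in
/-- A vertex with empty fibre has degree `0` read at it («`φ` is surjective if and only if
`deg(φ) > 0`», one direction). [cite: BakerNorine2009, Lemma 11] -/
theorem harmonicDegree_eq_zero_of_forall_ne {y : V'} (h : ∀ x, φ x ≠ y) :
    harmonicDegree G G' φ y = 0 := by
  rw [harmonicDegree_apply]
  exact Finset.sum_eq_zero fun x hx => absurd (mem_filter.1 hx).2 (h x)

/-- **Lemma 11 (second half)**: «`deg(φ) > 0` if and only if `φ` is surjective» (`G, G′`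
connected, `|V(G′)| > 1`). [cite: BakerNorine2009, Lemma 11] -/
theorem IsHarmonicMorphism.harmonicDegree_pos_iff_surjective [Nontrivial V'] (hG : G.Connected)
    (hG' : G'.Connected) (y₀ : V') : 0 < harmonicDegree G G' φ y₀ ↔ Function.Surjective φ := by
  constructor
  · intro h y
    by_contra hy
    push Not at hy
    have h0 := harmonicDegree_eq_zero_of_forall_ne (G := G) (G' := G') hy
    rw [hφ.harmonicDegree_eq hG' y y₀] at h0
    omega
  · intro hs
    rw [pos_iff_ne_zero, Ne, hφ.harmonicDegree_eq_zero_iff hG hG' y₀]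
    intro hconst
    obtain ⟨y₁, y₂, hne⟩ := exists_pair_ne V'
    obtain ⟨x₁, rfl⟩ := hs y₁
    obtain ⟨x₂, rfl⟩ := hs y₂
    exact hne (hconst x₁ x₂)

/-- A non-constant harmonic morphism of connected graphs is surjective («a harmonic morphism of
graphs must be either constant or surjective»). [cite: BakerNorine2009, Lemma 11] -/
theorem IsHarmonicMorphism.surjective_of_ne (hG : G.Connected) (hG' : G'.Connected) {x₁ x₂ : V}
    (hne : φ x₁ ≠ φ x₂) : Function.Surjective φ := by
  haveI : Nontrivial V' := ⟨⟨φ x₁, φ x₂, hne⟩⟩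
  refine (hφ.harmonicDegree_pos_iff_surjective hG hG' (φ x₁)).1 (pos_iff_ne_zero.2 fun h => ?_)
  exact hne (hφ.forall_eq_of_harmonicDegree_eq_zero hG hG' h x₁ x₂)

end ConstantOrSurjective

/-! ### §3 Lemma 24: `φ_* φ^* = deg(φ)` -/

section PushPull

variable {G G'} {φ : V → V'} (hφ : IsHarmonicMorphism G G' φ)
include hφ

/-- **Lemma 24**: `φ_*(φ^*(D′)) = deg(φ) D′` (`G′` connected, the degree read at any `y₀`).
[cite: BakerNorine2009, Lemma 24] -/
theorem IsHarmonicMorphism.divPushforward_divPullback (hG' : G'.Connected) (y₀ : V')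
    (D' : V' → ℤ) :
    divPushforward φ (divPullback G G' φ D') = (harmonicDegree G G' φ y₀ : ℤ) • D' := by
  funext y
  rw [divPushforward_apply, Pi.smul_apply, smul_eq_mul, hφ.harmonicDegree_eq hG' y₀ y,
    harmonicDegree_apply, Nat.cast_sum, Finset.sum_mul]
  refine Finset.sum_congr rfl fun x hx => ?_
  rw [divPullback_apply, (mem_filter.1 hx).2]

end PushPull

/-! ### §4 The push-forward of functions and Proposition 25 (4.1) -/

/-- The **push-forward of a function** `f : V(G) → ℤ`:
`φ_* f(y) = Σ_{x ∈ V(G), φ(x) = y} m_φ(x) f(x)`. [cite: BakerNorine2009, §4.1] -/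
noncomputable def fnPushforward (φ : V → V') (f : V → ℤ) : V' → ℤ :=
  fun y => ∑ x ∈ univ.filter (fun x => φ x = y), (horizMult G G' φ x : ℤ) * f x

/-- Unfolding `φ_* f`. [cite: BakerNorine2009, §4.1] -/
theorem fnPushforward_apply (φ : V → V') (f : V → ℤ) (y : V') :
    fnPushforward G G' φ f y =
      ∑ x ∈ univ.filter (fun x => φ x = y), (horizMult G G' φ x : ℤ) * f x := rfl

section PushPrincipal

variable {G G'} {φ : V → V'} (hφ : IsHarmonicMorphism G G' φ)
include hφ

/-- The number of neighbours of `u` in the fibre of `y`: `v_φ(u)` if `φ(u) = y`, `m_φ(u)` if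
`φ(u) ∼ y`, and `0` otherwise (every edge is horizontal or vertical).
[cite: BakerNorine2009, §2.1 (definitions of `v_φ`, `m_φ`) and Proposition 25 (proof)] -/
theorem IsHarmonicMorphism.card_neighborFinset_fiber (u : V) (y : V') :
    #{x ∈ G.neighborFinset u | φ x = y} =
      if φ u = y then vertMult G φ u else if G'.Adj (φ u) y then horizMult G G' φ u else 0 := by
  split_ifs with h1 h2
  · rw [vertMult_apply, h1]
  · rw [hφ.horizMult_eq h2]
  · rw [Finset.card_eq_zero, Finset.filter_eq_empty_iff]
    intro x hx hxy
    rw [mem_neighborFinset] at hx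
    rcases hφ.adj_or_eq hx with h | h
    · exact h2 (hxy ▸ h)
    · exact h1 (h ▸ hxy)

/-- The double count behind (4.1): summing `f` over the neighbours of the fibre of `y` gives
`Σ_{φ(u) = y} v_φ(u) f(u) + Σ_{z ∼ y} Σ_{φ(u) = z} m_φ(u) f(u)`.
[cite: BakerNorine2009, Proposition 25 (proof of (4.1))] -/
theorem IsHarmonicMorphism.sum_fiber_sum_neighborFinset (f : V → ℤ) (y : V') :
    ∑ x ∈ univ.filter (fun x => φ x = y), ∑ u ∈ G.neighborFinset x, f u =
      ∑ u ∈ univ.filter (fun u => φ u = y), (vertMult G φ u : ℤ) * f u +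
        ∑ z ∈ G'.neighborFinset y, fnPushforward G G' φ f z := by
  classical
  -- Step 1: swap the two sums — each `u` is counted once for each neighbour in the fibre of `y`
  have hswap : ∑ x ∈ univ.filter (fun x => φ x = y), ∑ u ∈ G.neighborFinset x, f u =
      ∑ u, (#{x ∈ G.neighborFinset u | φ x = y} : ℤ) * f u := by
    have h1 : ∀ x ∈ univ.filter (fun x => φ x = y), ∑ u ∈ G.neighborFinset x, f u =
        ∑ u, if G.Adj x u then f u else 0 := fun x _ => by
      rw [← Finset.sum_filter]
      congr 1
      ext u
      simp only [mem_neighborFinset, mem_filter, mem_univ, true_and]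
    rw [Finset.sum_congr rfl h1, Finset.sum_comm]
    refine Finset.sum_congr rfl fun u _ => ?_
    have hAB : (univ.filter (fun x => φ x = y)).filter (fun x => G.Adj x u) =
        ({x ∈ G.neighborFinset u | φ x = y} : Finset V) := by
      ext x
      simp only [mem_filter, mem_univ, true_and, mem_neighborFinset, G.adj_comm]
      exact and_comm
    rw [← Finset.sum_filter, Finset.sum_const, nsmul_eq_mul, hAB]
  rw [hswap]
  -- Step 2: sort the vertices `u` by their image `w = φ(u)`
  have hmaps : ∀ u ∈ (univ : Finset V), φ u ∈ (univ : Finset V') := fun u _ => mem_univ _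
  rw [← Finset.sum_fiberwise_of_maps_to hmaps]
  -- only `w = y` and the neighbours `w ∼ y` contribute
  have hvan : ∀ w ∈ (univ : Finset V'), w ∉ insert y (G'.neighborFinset y) →
      ∑ u ∈ univ.filter (fun u => φ u = w), (#{x ∈ G.neighborFinset u | φ x = y} : ℤ) * f u
        = 0 := by
    intro w _ hw
    rw [mem_insert, not_or, mem_neighborFinset] at hw
    refine Finset.sum_eq_zero fun u hu => ?_
    have huw : φ u = w := (mem_filter.1 hu).2
    rw [hφ.card_neighborFinset_fiber, if_neg (by rw [huw]; exact hw.1),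
      if_neg (by rw [huw, G'.adj_comm]; exact hw.2), Nat.cast_zero, zero_mul]
  rw [← Finset.sum_subset (subset_univ (insert y (G'.neighborFinset y))) hvan,
    Finset.sum_insert (G'.notMem_neighborFinset_self y)]
  congr 1
  · refine Finset.sum_congr rfl fun u hu => ?_
    rw [hφ.card_neighborFinset_fiber, if_pos (mem_filter.1 hu).2]
  · refine Finset.sum_congr rfl fun z hz => ?_
    rw [fnPushforward_apply]
    refine Finset.sum_congr rfl fun u hu => ?_
    have huz : φ u = z := (mem_filter.1 hu).2
    have hne : φ u ≠ y := by
      rw [huz]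
      exact G'.ne_of_adj ((mem_neighborFinset _ _ _).1 hz).symm
    have hadj : G'.Adj (φ u) y := by
      rw [huz, G'.adj_comm]
      exact (mem_neighborFinset _ _ _).1 hz
    rw [hφ.card_neighborFinset_fiber, if_neg hne, if_pos hadj]

/-- **Proposition 25 (4.1)**: `φ_*(div(f)) = div(φ_* f)`, i.e. `φ_*(Δ f) = Δ′(φ_* f)` — the
push-forward of a principal divisor is principal. [cite: BakerNorine2009, Proposition 25 (4.1)] -/
theorem IsHarmonicMorphism.divPushforward_lapMatrix_mulVec [DecidableEq V] (f : V → ℤ) :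
    divPushforward φ (G.lapMatrix ℤ *ᵥ f) = G'.lapMatrix ℤ *ᵥ fnPushforward G G' φ f := by
  funext y
  rw [divPushforward_apply, lapMatrix_mulVec_apply]
  simp only [lapMatrix_mulVec_apply, Finset.sum_sub_distrib]
  rw [hφ.sum_fiber_sum_neighborFinset f y, fnPushforward_apply, Finset.mul_sum]
  -- the degree identity `deg(x) = deg′(y) m_φ(x) + v_φ(x)` on the fibre of `y`
  have hdeg : ∀ x ∈ univ.filter (fun x => φ x = y), (G.degree x : ℤ) * f x =
      (G'.degree y : ℤ) * ((horizMult G G' φ x : ℤ) * f x) + (vertMult G φ x : ℤ) * f x := by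
    intro x hx
    rw [hφ.degree_eq x, (mem_filter.1 hx).2]
    push_cast
    ring
  rw [Finset.sum_congr rfl hdeg, Finset.sum_add_distrib]
  ring

/-- **Corollary 26 (push-forward half)**: `φ_*(Prin(G)) ⊆ Prin(G′)`.
[cite: BakerNorine2009, Corollary 26] -/
theorem IsHarmonicMorphism.divPushforward_mem_laplacianLattice [DecidableEq V] {P : V → ℤ}
    (hP : P ∈ laplacianLattice G) : divPushforward φ P ∈ laplacianLattice G' := by
  obtain ⟨f, rfl⟩ := (mem_laplacianLattice_iff G P).1 hP
  rw [mem_laplacianLattice_iff]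
  exact ⟨fnPushforward G G' φ f, (hφ.divPushforward_lapMatrix_mulVec f).symm⟩

/-- **`φ_*` preserves linear equivalence**: `D₁ ∼ D₂ ⟹ φ_* D₁ ∼ φ_* D₂` (so `φ_*` induces
`Jac(G) → Jac(G′)`). [cite: BakerNorine2009, Corollary 26] -/
theorem IsHarmonicMorphism.linEquiv_divPushforward [DecidableEq V] {D₁ D₂ : V → ℤ}
    (h : LinEquiv G D₁ D₂) : LinEquiv G' (divPushforward φ D₁) (divPushforward φ D₂) := by
  rw [linEquiv_iff] at h ⊢
  rw [← divPushforward_sub]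
  exact hφ.divPushforward_mem_laplacianLattice h

end PushPrincipal

/-! ### §5 The induced homomorphisms on Jacobians; Lemma 29 and Corollary 31 -/

section Jacobian

/-- `φ_*` as an additive homomorphism `Div(G) → Div(G′)`.
[cite: BakerNorine2009, §2.3 («the push-forward homomorphism»)] -/
def divPushforwardHom (φ : V → V') : (V → ℤ) →+ (V' → ℤ) where
  toFun := divPushforward φ
  map_zero' := divPushforward_zero φ
  map_add' := divPushforward_add φ

omit [Fintype V'] in
/-- `divPushforwardHom φ D = φ_* D`. [cite: BakerNorine2009, §2.3] -/
theorem divPushforwardHom_apply (φ : V → V') (D : V → ℤ) :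
    divPushforwardHom φ D = divPushforward φ D := rfl

/-- `φ_*` maps `Div⁰(G)` to `Div⁰(G′)`. [cite: BakerNorine2009, §4.1 (Lemma 29, proof)] -/
theorem divPushforward_mem_zeroSumLattice (φ : V → V') {D : V → ℤ} (hD : D ∈ zeroSumLattice V) :
    divPushforward φ D ∈ zeroSumLattice V' := by
  rw [mem_zeroSumLattice_iff, sum_divPushforward]
  exact hD

/-- `φ_*` restricted to degree-`0` divisors: `Div⁰(G) →+ Div⁰(G′)`.
[cite: BakerNorine2009, §4.1] -/
def divPushforwardHom₀ (φ : V → V') : zeroSumLattice V →+ zeroSumLattice V' :=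
  ((divPushforwardHom φ).comp (zeroSumLattice V).subtype).codRestrict (zeroSumLattice V')
    fun D => divPushforward_mem_zeroSumLattice φ D.2

/-- Value of `divPushforwardHom₀`. [cite: BakerNorine2009, §4.1] -/
theorem coe_divPushforwardHom₀ (φ : V → V') (D : zeroSumLattice V) :
    (divPushforwardHom₀ φ D : V' → ℤ) = divPushforward φ D := rfl

variable {G G'} {φ : V → V'}

/-- **The Albanese map `φ_* : Jac(G) → Jac(G′)`** induced by a harmonic morphism («`φ` induces
group homomorphisms […] `φ_* : Jac(G) → Jac(G′)`»). [cite: BakerNorine2009, §4.1 (after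
Corollary 26)] -/
def IsHarmonicMorphism.jacPushforward [DecidableEq V] (hφ : IsHarmonicMorphism G G' φ) :
    criticalGroup G →+ criticalGroup G' :=
  QuotientAddGroup.map _ _ (divPushforwardHom₀ φ) fun D hD => by
    rw [AddSubgroup.mem_comap, AddSubgroup.mem_addSubgroupOf, coe_divPushforwardHom₀]
    exact hφ.divPushforward_mem_laplacianLattice (AddSubgroup.mem_addSubgroupOf.1 hD)

/-- `φ_*[D] = [φ_* D]` on `Jac`. [cite: BakerNorine2009, §4.1] -/
theorem IsHarmonicMorphism.jacPushforward_mk [DecidableEq V] (hφ : IsHarmonicMorphism G G' φ)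
    (D : zeroSumLattice V) :
    hφ.jacPushforward (QuotientAddGroup.mk D : criticalGroup G) =
      QuotientAddGroup.mk (divPushforwardHom₀ φ D) :=
  QuotientAddGroup.map_mk _ _ _ _ D

/-- **Lemma 29**: for a surjective (i.e. non-constant, Lemma 11) harmonic morphism,
`φ_* : Jac(G) → Jac(G′)` is surjective. [cite: BakerNorine2009, Lemma 29] -/
theorem IsHarmonicMorphism.jacPushforward_surjective [DecidableEq V]
    (hφ : IsHarmonicMorphism G G' φ) (hφs : Function.Surjective φ) :
    Function.Surjective hφ.jacPushforward := by
  intro c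
  obtain ⟨D', rfl⟩ := QuotientAddGroup.mk_surjective c
  obtain ⟨D, hD, hsum, -⟩ := exists_divPushforward_eq hφs (D' : V' → ℤ)
  have hD0 : D ∈ zeroSumLattice V := by
    rw [mem_zeroSumLattice_iff, hsum]
    exact D'.2
  refine ⟨QuotientAddGroup.mk ⟨D, hD0⟩, ?_⟩
  rw [hφ.jacPushforward_mk]
  congr 1
  exact Subtype.ext hD

/-- **Lemma 29** for a non-constant harmonic morphism of connected graphs.
[cite: BakerNorine2009, Lemma 29 (with Lemma 11)] -/
theorem IsHarmonicMorphism.jacPushforward_surjective_of_ne [DecidableEq V]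
    (hφ : IsHarmonicMorphism G G' φ) (hG : G.Connected) (hG' : G'.Connected) {x₁ x₂ : V}
    (hne : φ x₁ ≠ φ x₂) : Function.Surjective hφ.jacPushforward :=
  hφ.jacPushforward_surjective (hφ.surjective_of_ne hG hG' hne)

/-- **Corollary 31** on Jacobians: `|Jac(G′)|` divides `|Jac(G)|` when there is a non-constant
harmonic morphism `G → G′` (connected graphs). [cite: BakerNorine2009, Corollary 31] -/
theorem IsHarmonicMorphism.card_criticalGroup_dvd [DecidableEq V] (hφ : IsHarmonicMorphism G G' φ)
    (hG : G.Connected) (hG' : G'.Connected) {x₁ x₂ : V} (hne : φ x₁ ≠ φ x₂) :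
    Nat.card (criticalGroup G') ∣ Nat.card (criticalGroup G) :=
  AddSubgroup.card_dvd_of_surjective _ (hφ.jacPushforward_surjective_of_ne hG hG' hne)

/-- **Corollary 31**: «If there exists a non-constant harmonic morphism from `G` to `G′`, then
`κ_{G′}` divides `κ_G`» — the numbers of spanning trees. [cite: BakerNorine2009, Corollary 31] -/
theorem IsHarmonicMorphism.card_spanningTrees_dvd [DecidableEq V] (hφ : IsHarmonicMorphism G G' φ)
    (hG : G.Connected) (hG' : G'.Connected) {x₁ x₂ : V} (hne : φ x₁ ≠ φ x₂) :
    Nat.card {T : SimpleGraph V' // T ≤ G' ∧ T.IsTree} ∣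
      Nat.card {T : SimpleGraph V // T ≤ G ∧ T.IsTree} := by
  rw [← card_criticalGroup G hG, ← card_criticalGroup G' hG']
  exact hφ.card_criticalGroup_dvd hG hG' hne

/-- `φ^*` maps `Div⁰(G′)` to `Div⁰(G)` (`G′` connected: `deg(φ^* D′) = deg(φ) deg(D′)`,
Lemma 15). [cite: BakerNorine2009, Lemma 15 and §4.1] -/
theorem IsHarmonicMorphism.divPullback_mem_zeroSumLattice (hφ : IsHarmonicMorphism G G' φ)
    (hG' : G'.Connected) {D' : V' → ℤ} (hD' : D' ∈ zeroSumLattice V') :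
    divPullback G G' φ D' ∈ zeroSumLattice V := by
  obtain ⟨y₀⟩ := hG'.nonempty
  rw [mem_zeroSumLattice_iff, hφ.sum_divPullback hG' y₀, (mem_zeroSumLattice_iff _).1 hD',
    mul_zero]

/-- `φ^*` restricted to degree-`0` divisors: `Div⁰(G′) →+ Div⁰(G)` (`G′` connected).
[cite: BakerNorine2009, §4.1] -/
noncomputable def IsHarmonicMorphism.divPullbackHom₀ (hφ : IsHarmonicMorphism G G' φ) (hG' : G'.Connected) :
    zeroSumLattice V' →+ zeroSumLattice V where
  toFun D' := ⟨divPullback G G' φ D', hφ.divPullback_mem_zeroSumLattice hG' D'.2⟩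
  map_zero' := Subtype.ext (funext fun x => by
    simp [divPullback_apply])
  map_add' D₁ D₂ := Subtype.ext (by
    simp only [AddSubgroup.coe_add]
    exact divPullback_add (D₁ : V' → ℤ) (D₂ : V' → ℤ))

/-- Value of `divPullbackHom₀`. [cite: BakerNorine2009, §4.1] -/
theorem IsHarmonicMorphism.coe_divPullbackHom₀ (hφ : IsHarmonicMorphism G G' φ)
    (hG' : G'.Connected) (D' : zeroSumLattice V') :
    (hφ.divPullbackHom₀ hG' D' : V → ℤ) = divPullback G G' φ D' := rfl

/-- **The Picard map `φ^* : Jac(G′) → Jac(G)`** induced by a harmonic morphism onto a connected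
`G′` («`φ` induces group homomorphisms […] `φ^* : Jac(G′) → Jac(G)`»).
[cite: BakerNorine2009, §4.1 (after Corollary 26)] -/
noncomputable def IsHarmonicMorphism.jacPullback [DecidableEq V] (hφ : IsHarmonicMorphism G G' φ)
    (hG' : G'.Connected) : criticalGroup G' →+ criticalGroup G :=
  QuotientAddGroup.map _ _ (hφ.divPullbackHom₀ hG') fun D' hD' => by
    rw [AddSubgroup.mem_comap, AddSubgroup.mem_addSubgroupOf, hφ.coe_divPullbackHom₀]
    have h := AddSubgroup.mem_addSubgroupOf.1 hD'
    obtain ⟨f, hf⟩ := (mem_laplacianLattice_iff G' _).1 h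
    rw [mem_laplacianLattice_iff]
    exact ⟨f ∘ φ, by rw [← hf, hφ.divPullback_lapMatrix_mulVec]⟩

/-- `φ^*[D′] = [φ^* D′]` on `Jac`. [cite: BakerNorine2009, §4.1] -/
theorem IsHarmonicMorphism.jacPullback_mk [DecidableEq V] (hφ : IsHarmonicMorphism G G' φ)
    (hG' : G'.Connected) (D' : zeroSumLattice V') :
    hφ.jacPullback hG' (QuotientAddGroup.mk D' : criticalGroup G') =
      QuotientAddGroup.mk (hφ.divPullbackHom₀ hG' D') :=
  QuotientAddGroup.map_mk _ _ _ _ D'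

/-- **Lemma 24 on Jacobians**: `φ_* ∘ φ^* = deg(φ)` (the degree read at any `y₀`).
[cite: BakerNorine2009, Lemma 24] -/
theorem IsHarmonicMorphism.jacPushforward_jacPullback [DecidableEq V]
    (hφ : IsHarmonicMorphism G G' φ) (hG' : G'.Connected) (y₀ : V') (c : criticalGroup G') :
    hφ.jacPushforward (hφ.jacPullback hG' c) = harmonicDegree G G' φ y₀ • c := by
  obtain ⟨D', rfl⟩ := QuotientAddGroup.mk_surjective c
  rw [hφ.jacPullback_mk, hφ.jacPushforward_mk, ← QuotientAddGroup.mk_nsmul]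
  congr 1
  apply Subtype.ext
  rw [coe_divPushforwardHom₀, hφ.coe_divPullbackHom₀, AddSubgroup.coe_nsmul,
    hφ.divPushforward_divPullback hG' y₀, natCast_zsmul]

end Jacobian

/-! ### §6 Corollary 28: `r_{G′}(φ_*(D)) ≥ r_G(D)` -/

section Rank

variable {G G'} {φ : V → V'} (hφ : IsHarmonicMorphism G G' φ)
include hφ

/-- **Corollary 28**: for a surjective (i.e. non-constant) harmonic morphism,
`r_{G′}(φ_*(D)) ≥ r_G(D)` for every divisor `D`. [cite: BakerNorine2009, Corollary 28] -/
theorem IsHarmonicMorphism.rank_le_rank_divPushforward [DecidableEq V] (hG : G.Connected)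
    (hφs : Function.Surjective φ) (D : V → ℤ) :
    rank G D ≤ rank G' (divPushforward φ D) := by
  haveI : Nonempty V := hG.nonempty
  obtain ⟨x₀⟩ := ‹Nonempty V›
  haveI : Nonempty V' := ⟨φ x₀⟩
  -- `r_G(D) = −1` is trivial; otherwise test every effective `E′` of degree `k ≤ r_G(D)`
  rcases eq_or_lt_of_le (neg_one_le_rank G D) with h | h
  · rw [← h]
    exact neg_one_le_rank G' _
  · obtain ⟨k, hk⟩ : ∃ k : ℕ, rank G D = k := ⟨(rank G D).toNat, (Int.toNat_of_nonneg (by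
      omega)).symm⟩
    rw [hk, le_rank_iff]
    intro E' hE' hE's
    obtain ⟨E, hEE', hEs, hEnn⟩ := exists_divPushforward_eq hφs E'
    have hw : Winnable G (D - E) :=
      (le_rank_iff G D k).1 hk.ge E (hEnn hE') (by rw [hEs, hE's])
    obtain ⟨F, hF, hDEF⟩ := hw
    refine ⟨divPushforward φ F, divPushforward_nonneg φ hF, ?_⟩
    rw [← hEE', ← divPushforward_sub]
    exact hφ.linEquiv_divPushforward hDEF

/-- **Corollary 28** for a non-constant harmonic morphism of connected graphs.
[cite: BakerNorine2009, Corollary 28 (with Lemma 11)] -/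
theorem IsHarmonicMorphism.rank_le_rank_divPushforward_of_ne [DecidableEq V] (hG : G.Connected)
    (hG' : G'.Connected) {x₁ x₂ : V} (hne : φ x₁ ≠ φ x₂) (D : V → ℤ) :
    rank G D ≤ rank G' (divPushforward φ D) :=
  hφ.rank_le_rank_divPushforward hG (hφ.surjective_of_ne hG hG' hne) D

end Rank

end Literature.Combinatorics.SimpleGraph.BakerNorine
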